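import Literature.AnabelianGeometry.EtaleTheta.SettingModelTateTheta
import Literature.AnabelianGeometry.EtaleTheta.SettingModelTateYTheta
import Literature.AnabelianGeometry.EtaleTheta.SettingModelTateDeltaTheta
import Literature.AnabelianGeometry.EtaleTheta.SettingModelTateCusp
import Literature.AnabelianGeometry.EtaleTheta.SettingModelTateDoubleUnderline
import Literature.AnabelianGeometry.EtaleTheta.EtaleThetaClass
import HarnessLib

/-!
# The STAGE-2 («Tate shear») model of [EtTh] §1 (R78), F7q part 1: the `z`-COORDINATE CLASS on `(Π^tp_Y)^Θ` of
# `modelχq` — a NAMED lift of `log(Θ)` to `F⁰ = H¹((Π^tp_Y)^Θ, Δ_Θ)` and `F̈⁰ = H¹((Π^tp_Ÿ)^Θ, Δ_Θ)`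

S. Mochizuki, *The étale theta function and its Frobenioid-theoretic manifestations*, Publ. RIMS **45** (2009)
[EtTh], §1, Prop. 1.5 (i)–(iii) p. 23 ("`F⁰/F¹ = Hom(Δ_Θ, Δ_Θ) = Ẑ·log(Θ)`", "any class `η̈^Θ ∈ H¹(Π^tp_Ÿ, Δ_Θ)` arises
from a unique class `η̈^Θ ∈ H¹((Π^tp_Ÿ)^Θ, Δ_Θ)` that maps to `log(Θ)` in the quotient `F̈⁰/F̈¹` and on which `a ∈ Z`
acts as follows …") [cite: MochizukiEtTh2009, Prop 1.5 (iii) p.23]. Layer L2 of the abc-iut cell, seat abc-iut-L2-t6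
(gen 6), R78 cluster hand #4, **F7q** (the Prop. 1.5 (iii) witness at the stage-2 model, MAP #5) — part 1, the lift
`x′`; transcription to `ThetaSetting.modelχq p i j` (abc-iut-L2-t5's F5q: `Π^tp_X := Γ ⋊_{actχq} G_{ℚ_p}`,
`actχq σ = Inn(b^{κ_p(σ)^i}) ∘ shear_{κ_p(σ)^j} ∘ θ_{χ(σ)}`) of this seat's stage-1 file `SettingModelChiZClass`,
over abc-iut-w5-d171's `yCoordχq`/`yThetaχq`/`yThetaχq_mul` (`SettingModelTateYTheta`), abc-iut-L6-d6's
`cThetaχq`/`conj_cThetaχq`/`exists_cThetaχq_eq_of_mem_ker`/`mem_ellKerχq_iff` (`SettingModelTateDeltaTheta`) and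
abc-iut-L2-t5's `actχq_bPowGfp` (`SettingModelTateCusp`); the record-keyed instances on `Δ_Θ(modelχq)` are
abc-iut's `SettingModelTateDoubleUnderline` — consumed BY NAME, nothing restated. Class (b) CONSTRUCTION
over the frozen interface (definitions `refReprχq`, `refLiftχq`, `zPartχq`, `zFunχq`, `zClassχq` (+ the two
specialisations); no instance, no notation, no `Prop` fact).

WHAT. The Tate shear does NOT act on the `b`-axis (`actχq σ (b^t) = b^{χ(σ)t}`) and does not move the `b`-exponent
on `Ker ê ⊇ pr₁(Π^tp_Y)`; hence on `(Π^tp_Y)^Θ` the stage-1 construction goes through verbatim: the reference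
representative `refReprχq h := ⟨b^{ŷ(h)}, aug^Θ h⟩` is multiplicative in the second variable along `(Π^tp_Y)^Θ`
(`refReprχq_mul`), the `z`-part `zPartχq h := h · θ(refReprχq h)⁻¹` lies in `Δ_Θ` for `h ∈ (Π^tp_Y)^Θ`
(`zPartχq_mem_deltaTheta`), is the identity on `Δ_Θ` (`zPartχq_eq_of_mem_deltaTheta`), and satisfies the cocycle
law (`zPartχq_mul`; conjugation on `Δ_Θ ≅ Ẑ(χ)` factors through `aug^Θ`, `conj_cThetaχq`). So
**`zClassχq H hH ∈ H¹(H, Δ_Θ)`** for every `H ≤ (Π^tp_Y)^Θ`, with **`res_{Δ_Θ} zClassχq = log(Θ)`**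
(`res_zClassχq_eq_logTheta`) — the NAMED lift `x′` (`zClassYddχq`) that abc-iut-L2-t12's
`KummerCore.prop15iii_etaleThetaDataOfClass_ofSection_of_generator` consumes at the stage-2 model; its inflation
`etaDdχq := infl zClassYddχq ∈ H¹(Π^tp_Ÿ, Δ_Θ)` is the stage-2 model's class "without denominators".

HONEST FRAMING: SEMI-SYNTHETIC model (the Tate-sheared χ-twisted root; not the tempered `π₁` of a curve, no theta
FUNCTION) — consistency / non-vacuity evidence for the typed interface ONLY; nothing of [EtTh] is asserted;
typed ≠ proved; no side is taken on [IUTchIII] Cor. 3.12.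
-/

noncomputable section

namespace Literature.AnabelianGeometry.EtaleTheta.SettingModel

open Literature.AnabelianGeometry.SemiGraphs _root_.Topology _root_.Function

variable (p : ℕ) [Fact p.Prime] (i j : ℤ)

/-! ### `ŷ` and `aug^Θ` on `Δ_Θ`; `ŷ(1)` -/

/-- `ŷ(1) = 0` (stage 2). [cite: MochizukiEtTh2009, Prop 1.5 p.23] -/
theorem yThetaχq_one : yThetaχq p i j 1 = 1 := by
  rw [← map_one (CurveTheta.toTheta (curveχq p i j)), yThetaχq_toTheta]
  show eHatB (gfpFst (1 : PiTpχq p i j).left) = 1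
  rw [SemidirectProduct.one_left, map_one, map_one]

/-- **`ŷ` vanishes on `Δ_Θ`** (stage 2): elements of `Δ_Θ` have all level `y`-coordinates `0`.
[cite: MochizukiEtTh2009, Prop 1.5 p.23] -/
theorem yThetaχq_eq_one_of_mem_deltaTheta {d : CurveTheta.GTheta (curveχq p i j)}
    (hd : d ∈ (CurveTheta.thetaToEll (curveχq p i j)).ker) : yThetaχq p i j d = 1 := by
  obtain ⟨g, rfl⟩ := CurveTheta.toTheta_surjective (curveχq p i j) d
  have hg : g ∈ CurveTheta.ellKer (curveχq p i j) := (CurveTheta.mk_mem_ker_thetaToEll_iff (curveχq p i j) g).mp hd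
  obtain ⟨hxy, -⟩ := (mem_ellKerχq_iff p i j g).mp hg
  rw [yThetaχq_toTheta]
  show eHatB (gfpFst g.left) = 1
  refine ext_of_modN fun N => ?_
  rw [map_one]
  exact (hHat_y_eq_zero_iff N _).mp (hxy N).2

/-- `aug^Θ` vanishes on `Δ_Θ` (stage 2). [cite: MochizukiEtTh2009, §1 p.12] -/
theorem augThetaq_eq_one_of_mem_deltaTheta {d : CurveTheta.GTheta (curveχq p i j)}
    (hd : d ∈ (CurveTheta.thetaToEll (curveχq p i j)).ker) : CurveTheta.augTheta (curveχq p i j) d = 1 := by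
  obtain ⟨g, rfl⟩ := CurveTheta.toTheta_surjective (curveχq p i j) d
  have hg : g ∈ CurveTheta.ellKer (curveχq p i j) := (CurveTheta.mk_mem_ker_thetaToEll_iff (curveχq p i j) g).mp hd
  obtain ⟨-, hr⟩ := (mem_ellKerχq_iff p i j g).mp hg
  rw [CurveTheta.augTheta_toTheta]
  exact hr

/-- `Γ`-components of elements of `Π^tp_Y` (stage 2) have degree `0`. [cite: MochizukiEtTh2009, §1 p.13] -/
theorem gfpSnd_left_eq_one_of_mem_gtpY_modelχq (hj : Even j) {g : PiTpχq p i j}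
    (hg : g ∈ (ThetaSetting.modelχq p i j hj).GtpY) : gfpSnd g.left = 1 := by
  have h' : (tateTwistData₀ p i j).toZ g = 1 := hg
  rwa [GfpTwistData₀.toZ_apply] at h'

/-! ### The reference representative `h ↦ ⟨b^{ŷ(h)}, aug^Θ h⟩` -/

/-- The `b`-axis representative `⟨b^{ŷ(h)}, aug^Θ h⟩ ∈ Π^tp_X` of `h ∈ (Π^tp_X)^Θ` (stage 2). [cite: MochizukiEtTh2009, Prop 1.5 p.23] -/
def refReprχq (h : CurveTheta.GTheta (curveχq p i j)) : PiTpχq p i j :=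
  ⟨bPowGfp (yThetaχq p i j h), CurveTheta.augTheta (curveχq p i j) h⟩

/-- [cite: MochizukiEtTh2009, Prop 1.5 p.23] -/
@[simp] theorem refReprχq_left (h : CurveTheta.GTheta (curveχq p i j)) :
    (refReprχq p i j h).left = bPowGfp (yThetaχq p i j h) := rfl

/-- [cite: MochizukiEtTh2009, Prop 1.5 p.23] -/
@[simp] theorem refReprχq_right (h : CurveTheta.GTheta (curveχq p i j)) :
    (refReprχq p i j h).right = CurveTheta.augTheta (curveχq p i j) h := rfl

/-- `refReprχq` is multiplicative whenever the second factor is represented in `Ker ê` (e.g. lies in `(Π^tp_Y)^Θ`):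
the crossed law `ŷ(hk) = ŷ(h)·χ(aug^Θ h)(ŷ(k))` there matches `⟨b^s, σ⟩⟨b^t, τ⟩ = ⟨b^{s + χ(σ)t}, στ⟩` — the shear
does not act on `b^t`. [cite: MochizukiEtTh2009, Prop 1.5 p.23] -/
theorem refReprχq_mul (h : CurveTheta.GTheta (curveχq p i j)) (g : PiTpχq p i j) (hg : eHat (gfpFst g.left) = 1) :
    refReprχq p i j (h * CurveTheta.toTheta (curveχq p i j) g) =
      refReprχq p i j h * refReprχq p i j (CurveTheta.toTheta (curveχq p i j) g) := by
  refine SemidirectProduct.ext ?_ ?_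
  · rw [SemidirectProduct.mul_left, refReprχq_left, refReprχq_left, refReprχq_left, refReprχq_right,
      yThetaχq_mul p i j h g hg, map_mul, actχq_bPowGfp, cocyclePairHom_right]
  · rw [SemidirectProduct.mul_right, refReprχq_right, refReprχq_right, refReprχq_right, map_mul]

/-- `refReprχq 1 = 1`. [cite: MochizukiEtTh2009, Prop 1.5 p.23] -/
theorem refReprχq_one : refReprχq p i j 1 = 1 := by
  refine SemidirectProduct.ext ?_ ?_
  · rw [refReprχq_left, yThetaχq_one, map_one, SemidirectProduct.one_left]
  · rw [refReprχq_right, map_one, SemidirectProduct.one_right]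

/-- `refReprχq` is continuous. [cite: MochizukiEtTh2009, Prop 1.5 p.23] -/
theorem continuous_refReprχq : Continuous (refReprχq p i j) :=
  (Semidirect.continuous_iff_left_right (isInducing_leftRightχq p i j)).2
    ⟨bPowGfp.continuous.comp (continuous_yThetaχq p i j), CurveTheta.continuous_augTheta (curveχq p i j)⟩

/-- **The reference lift** `refLiftχq h := θ⟨b^{ŷ(h)}, aug^Θ h⟩ ∈ (Π^tp_X)^Θ` (stage 2). [cite: MochizukiEtTh2009, Prop 1.5 p.23] -/
def refLiftχq (h : CurveTheta.GTheta (curveχq p i j)) : CurveTheta.GTheta (curveχq p i j) :=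
  CurveTheta.toTheta (curveχq p i j) (refReprχq p i j h)

/-- [cite: MochizukiEtTh2009, Prop 1.5 p.23] -/
theorem refLiftχq_def (h : CurveTheta.GTheta (curveχq p i j)) :
    refLiftχq p i j h = CurveTheta.toTheta (curveχq p i j) (refReprχq p i j h) := rfl

/-- `refLiftχq` is multiplicative along second factors represented in `Ker ê`. [cite: MochizukiEtTh2009, Prop 1.5 p.23] -/
theorem refLiftχq_mul (h : CurveTheta.GTheta (curveχq p i j)) (g : PiTpχq p i j) (hg : eHat (gfpFst g.left) = 1) :
    refLiftχq p i j (h * CurveTheta.toTheta (curveχq p i j) g) =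
      refLiftχq p i j h * refLiftχq p i j (CurveTheta.toTheta (curveχq p i j) g) := by
  rw [refLiftχq_def, refLiftχq_def, refLiftχq_def, refReprχq_mul p i j h g hg, map_mul]

/-- `refLiftχq` is continuous. [cite: MochizukiEtTh2009, Prop 1.5 p.23] -/
theorem continuous_refLiftχq : Continuous (refLiftχq p i j) :=
  (CurveTheta.continuous_toTheta (curveχq p i j)).comp (continuous_refReprχq p i j)

/-- `aug^Θ ∘ refLiftχq = aug^Θ`. [cite: MochizukiEtTh2009, Prop 1.5 p.23] -/
theorem augTheta_refLiftχq (h : CurveTheta.GTheta (curveχq p i j)) :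
    CurveTheta.augTheta (curveχq p i j) (refLiftχq p i j h) = CurveTheta.augTheta (curveχq p i j) h := by
  rw [refLiftχq_def, CurveTheta.augTheta_toTheta]
  rfl

/-- `refLiftχq` kills `Δ_Θ`. [cite: MochizukiEtTh2009, Prop 1.5 p.23] -/
theorem refLiftχq_eq_one_of_mem_deltaTheta {d : CurveTheta.GTheta (curveχq p i j)}
    (hd : d ∈ (CurveTheta.thetaToEll (curveχq p i j)).ker) : refLiftχq p i j d = 1 := by
  rw [refLiftχq_def, ← map_one (CurveTheta.toTheta (curveχq p i j))]
  congr 1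
  refine SemidirectProduct.ext ?_ ?_
  · rw [refReprχq_left, yThetaχq_eq_one_of_mem_deltaTheta p i j hd, map_one, SemidirectProduct.one_left]
  · rw [refReprχq_right, augThetaq_eq_one_of_mem_deltaTheta p i j hd, SemidirectProduct.one_right]

/-- **Conjugation on `Δ_Θ` through `refLiftχq`**: `g d g⁻¹ = r(g) d r(g)⁻¹` for `d ∈ Δ_Θ` (both act through
`χ ∘ aug^Θ` — the shear acts trivially on the centre). [cite: MochizukiEtTh2009, §1 p.12] -/
theorem conj_eq_conj_refLiftχq (g : CurveTheta.GTheta (curveχq p i j)) {d : CurveTheta.GTheta (curveχq p i j)}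
    (hd : d ∈ (CurveTheta.thetaToEll (curveχq p i j)).ker) :
    g * d * g⁻¹ = refLiftχq p i j g * d * (refLiftχq p i j g)⁻¹ := by
  obtain ⟨t, rfl⟩ := exists_cThetaχq_eq_of_mem_ker p i j hd
  rw [conj_cThetaχq, conj_cThetaχq, augTheta_refLiftχq]

/-! ### The `z`-part of an element of `(Π^tp_Y)^Θ` -/

/-- **The `z`-part** `zPartχq h := h · refLiftχq(h)⁻¹` (stage 2). [cite: MochizukiEtTh2009, Prop 1.5 p.23] -/
def zPartχq (h : CurveTheta.GTheta (curveχq p i j)) : CurveTheta.GTheta (curveχq p i j) := h * (refLiftχq p i j h)⁻¹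

/-- [cite: MochizukiEtTh2009, Prop 1.5 p.23] -/
theorem zPartχq_def (h : CurveTheta.GTheta (curveχq p i j)) : zPartχq p i j h = h * (refLiftχq p i j h)⁻¹ := rfl

/-- `zPartχq` is continuous. [cite: MochizukiEtTh2009, Prop 1.5 p.23] -/
theorem continuous_zPartχq : Continuous (zPartχq p i j) := continuous_id.mul (continuous_refLiftχq p i j).inv

/-- The representative `g · ⟨b^{ŷ(g)}, g.right⟩⁻¹` of the `z`-part of `θ(g)` is `inl(g.left · b^{−ŷ(g)})` (stage 2).
[cite: MochizukiEtTh2009, Prop 1.5 p.23] -/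
theorem mul_refReprχq_inv_eq_inl (g : PiTpχq p i j) :
    g * (refReprχq p i j (CurveTheta.toTheta (curveχq p i j) g))⁻¹ =
      SemidirectProduct.inl (g.left * (bPowGfp (yCoordχq p i j g))⁻¹) := by
  refine SemidirectProduct.ext ?_ ?_
  · rw [SemidirectProduct.mul_left, SemidirectProduct.inv_left, refReprχq_left, refReprχq_right, yThetaχq_toTheta,
      CurveTheta.augTheta_toTheta, SemidirectProduct.left_inl, ← MulAut.mul_apply, ← map_mul]
    change g.left * actχq p i j (g.right * g.right⁻¹) (bPowGfp (yCoordχq p i j g))⁻¹ = _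
    rw [mul_inv_cancel, map_one, MulAut.one_apply]
  · rw [SemidirectProduct.mul_right, SemidirectProduct.inv_right, refReprχq_right, CurveTheta.augTheta_toTheta,
      SemidirectProduct.right_inl]
    exact mul_inv_cancel _

/-- **The `z`-part of an element of `(Π^tp_Y)^Θ` lies in `Δ_Θ`** (stage 2): for `g ∈ Π^tp_Y` the element
`g.left · b^{−ŷ(g)} ∈ Γ` has all level `x`- and `y`-coordinates `0`. [cite: MochizukiEtTh2009, Prop 1.5 p.23] -/
theorem zPartχq_mem_deltaTheta (hj : Even j) {h : CurveTheta.GTheta (curveχq p i j)}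
    (hh : h ∈ (ThetaSetting.modelχq p i j hj).GtpY.map (ThetaSetting.modelχq p i j hj).toTheta) :
    zPartχq p i j h ∈ (ThetaSetting.modelχq p i j hj).DeltaTheta := by
  obtain ⟨g, hg, rfl⟩ := hh
  have hg0 : gfpSnd g.left = 1 := gfpSnd_left_eq_one_of_mem_gtpY_modelχq p i j hj hg
  change CurveTheta.toTheta (curveχq p i j) g * (CurveTheta.toTheta (curveχq p i j) (refReprχq p i j _))⁻¹ ∈
    (CurveTheta.thetaToEll (curveχq p i j)).ker
  rw [← map_inv, ← map_mul, mul_refReprχq_inv_eq_inl, CurveTheta.mk_mem_ker_thetaToEll_iff, mem_ellKerχq_iff]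
  refine ⟨fun N => ?_, SemidirectProduct.right_inl _⟩
  rw [SemidirectProduct.left_inl, map_mul, map_inv, map_mul, map_inv, gfpFst_bPowGfp, hHat_bPow]
  have hx : (hHat N (gfpFst g.left)).x = 0 := levelHom_x_eq_zero hg0
  have hy : (hHat N (gfpFst g.left)).y = Multiplicative.toAdd (ZHatLevel.level N (yCoordχq p i j g)) := by
    rw [← modN_eq_level, yCoordχq_apply, ← hHat_y_eq_modN_eHatB, toAdd_ofAdd]
  refine ⟨?_, ?_⟩
  · rw [Heis.mul_x, Heis.inv_x, hx]
    simp
  · rw [Heis.mul_y, Heis.inv_y, hy]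
    simp

/-- **The `z`-part is the identity on `Δ_Θ`** (stage 2). [cite: MochizukiEtTh2009, Prop 1.5 p.23] -/
theorem zPartχq_eq_of_mem_deltaTheta {d : CurveTheta.GTheta (curveχq p i j)}
    (hd : d ∈ (CurveTheta.thetaToEll (curveχq p i j)).ker) : zPartχq p i j d = d := by
  rw [zPartχq_def, refLiftχq_eq_one_of_mem_deltaTheta p i j hd, inv_one, mul_one]

/-- **The cocycle identity** `z(gh) = z(g) · g z(h) g⁻¹` for `h ∈ (Π^tp_Y)^Θ` (stage 2). [cite: MochizukiEtTh2009, Prop 1.5 p.23] -/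
theorem zPartχq_mul (hj : Even j) {g h : CurveTheta.GTheta (curveχq p i j)}
    (hh : h ∈ (ThetaSetting.modelχq p i j hj).GtpY.map (ThetaSetting.modelχq p i j hj).toTheta) :
    zPartχq p i j (g * h) = zPartχq p i j g * (g * zPartχq p i j h * g⁻¹) := by
  rw [conj_eq_conj_refLiftχq p i j g (zPartχq_mem_deltaTheta p i j hj hh)]
  obtain ⟨k, hk, rfl⟩ := hh
  have hk1 : eHat (gfpFst k.left) = 1 :=
    eHat_gfpFst_left_eq_one p i j (gfpSnd_left_eq_one_of_mem_gtpY_modelχq p i j hj hk)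
  change zPartχq p i j (g * CurveTheta.toTheta (curveχq p i j) k) = _
  rw [zPartχq_def, zPartχq_def, zPartχq_def, refLiftχq_mul p i j g k hk1, mul_inv_rev]
  group

/-! ### The `z`-class -/

/-- **The `z`-coordinate cocycle** on a subgroup `H ≤ (Π^tp_Y)^Θ` of the stage-2 model, valued in `Δ_Θ(modelχq)`.
[cite: MochizukiEtTh2009, Prop 1.5 p.23] -/
def zFunχq (hj : Even j) (H : Subgroup (CurveTheta.GTheta (curveχq p i j)))
    (hH : H ≤ (ThetaSetting.modelχq p i j hj).GtpY.map (ThetaSetting.modelχq p i j hj).toTheta) :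
    H → (ThetaSetting.modelχq p i j hj).DeltaTheta :=
  fun h => ⟨zPartχq p i j h, zPartχq_mem_deltaTheta p i j hj (hH h.2)⟩

/-- [cite: MochizukiEtTh2009, Prop 1.5 p.23] -/
@[simp] theorem coe_zFunχq (hj : Even j) (H : Subgroup (CurveTheta.GTheta (curveχq p i j)))
    (hH : H ≤ (ThetaSetting.modelχq p i j hj).GtpY.map (ThetaSetting.modelχq p i j hj).toTheta) (h : H) :
    ((zFunχq p i j hj H hH h : (ThetaSetting.modelχq p i j hj).DeltaTheta) : CurveTheta.GTheta (curveχq p i j)) =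
      zPartχq p i j h := rfl

/-- **It is a continuous `1`-cocycle.** [cite: MochizukiEtTh2009, Prop 1.5 p.23] -/
theorem zFunχq_mem (hj : Even j) (H : Subgroup (CurveTheta.GTheta (curveχq p i j)))
    (hH : H ≤ (ThetaSetting.modelχq p i j hj).GtpY.map (ThetaSetting.modelχq p i j hj).toTheta) :
    zFunχq p i j hj H hH ∈
      contCocycles (MonoidHom.id (CurveTheta.GTheta (curveχq p i j))) (ThetaSetting.modelχq p i j hj).DeltaTheta H := by
  refine ⟨((continuous_zPartχq p i j).comp continuous_subtype_val).subtype_mk _, fun g h => Subtype.ext ?_⟩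
  change zPartχq p i j ((g : CurveTheta.GTheta (curveχq p i j)) * h) =
    zPartχq p i j g * ((g : CurveTheta.GTheta (curveχq p i j)) * zPartχq p i j h *
      (g : CurveTheta.GTheta (curveχq p i j))⁻¹)
  exact zPartχq_mul p i j hj (hH h.2)

/-- **The `z`-class `∈ H¹(H, Δ_Θ)`** of the stage-2 model for `H ≤ (Π^tp_Y)^Θ`. [cite: MochizukiEtTh2009, Prop 1.5 p.23] -/
def zClassχq (hj : Even j) (H : Subgroup (CurveTheta.GTheta (curveχq p i j)))
    (hH : H ≤ (ThetaSetting.modelχq p i j hj).GtpY.map (ThetaSetting.modelχq p i j hj).toTheta) :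
    (ThetaSetting.modelχq p i j hj).H1Theta H :=
  ContH1.mk (zFunχq p i j hj H hH) (zFunχq_mem p i j hj H hH)

/-- [cite: MochizukiEtTh2009, Prop 1.5 p.23] -/
theorem zClassχq_def (hj : Even j) (H : Subgroup (CurveTheta.GTheta (curveχq p i j)))
    (hH : H ≤ (ThetaSetting.modelχq p i j hj).GtpY.map (ThetaSetting.modelχq p i j hj).toTheta) :
    zClassχq p i j hj H hH = ContH1.mk (zFunχq p i j hj H hH) (zFunχq_mem p i j hj H hH) := rfl

/-- Compatibility under restriction. [cite: MochizukiEtTh2009, Prop 1.5 p.23] -/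
theorem res_zClassχq (hj : Even j) {H H' : Subgroup (CurveTheta.GTheta (curveχq p i j))}
    (hH : H ≤ (ThetaSetting.modelχq p i j hj).GtpY.map (ThetaSetting.modelχq p i j hj).toTheta) (hle : H' ≤ H) :
    ContH1.res (MonoidHom.id (CurveTheta.GTheta (curveχq p i j))) (ThetaSetting.modelχq p i j hj).DeltaTheta hle
        (zClassχq p i j hj H hH) = zClassχq p i j hj H' (hle.trans hH) := by
  change ContH1.mk _ _ = ContH1.mk _ _
  exact ContH1.mk_congr _ (funext fun h => rfl) _ _

/-- **`res_{Δ_Θ}(z-class) = log(Θ)`** (stage 2). [cite: MochizukiEtTh2009, Prop 1.5 (iii) p.23] -/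
theorem res_zClassχq_eq_logTheta (hj : Even j) {H : Subgroup (CurveTheta.GTheta (curveχq p i j))}
    (hH : H ≤ (ThetaSetting.modelχq p i j hj).GtpY.map (ThetaSetting.modelχq p i j hj).toTheta)
    (hle : (ThetaSetting.modelχq p i j hj).DeltaTheta ≤ H) :
    ContH1.res (MonoidHom.id (CurveTheta.GTheta (curveχq p i j))) (ThetaSetting.modelχq p i j hj).DeltaTheta hle
        (zClassχq p i j hj H hH) = (ThetaSetting.modelχq p i j hj).logTheta := by
  change ContH1.mk _ _ = ContH1.mk _ _
  exact ContH1.mk_congr _ (funext fun d => Subtype.ext (zPartχq_eq_of_mem_deltaTheta p i j d.2)) _ _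

/-! ### On `(Π^tp_Y)^Θ`, `(Π^tp_Ÿ)^Θ`; the stage-2 class `η̈♯` -/

/-- The `z`-class on `(Π^tp_Y)^Θ` (stage 2): a lift of `log(Θ)` to `F⁰`. [cite: MochizukiEtTh2009, Prop 1.5 (i) p.23] -/
def zClassYχq (hj : Even j) :
    (ThetaSetting.modelχq p i j hj).H1Theta
      ((ThetaSetting.modelχq p i j hj).GtpY.map (ThetaSetting.modelχq p i j hj).toTheta) :=
  zClassχq p i j hj _ le_rfl

/-- The `z`-class on `(Π^tp_Ÿ)^Θ` (stage 2): a lift of `log(Θ)` to `F̈⁰`. [cite: MochizukiEtTh2009, Prop 1.5 (ii) p.23] -/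
def zClassYddχq (hj : Even j) :
    (ThetaSetting.modelχq p i j hj).H1Theta
      ((ThetaSetting.modelχq p i j hj).GtpYdd.map (ThetaSetting.modelχq p i j hj).toTheta) :=
  zClassχq p i j hj _ (Subgroup.map_mono (ThetaSetting.modelχq p i j hj).GtpYdd_le_GtpY)

/-- `zClassYχq|_{(Π^tp_Ÿ)^Θ} = zClassYddχq`. [cite: MochizukiEtTh2009, Prop 1.5 p.23] -/
theorem res_zClassYχq (hj : Even j) :
    ContH1.res (MonoidHom.id (CurveTheta.GTheta (curveχq p i j))) (ThetaSetting.modelχq p i j hj).DeltaTheta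
      (ThetaSetting.modelχq p i j hj).GtpYddTheta_le (zClassYχq p i j hj) = zClassYddχq p i j hj :=
  res_zClassχq p i j hj _ _

/-- **`res_{Δ_Θ} zClassYχq = log(Θ)`** (stage 2). [cite: MochizukiEtTh2009, Prop 1.5 (i) p.23] -/
theorem res_zClassYχq_eq_logTheta (hj : Even j) (hC : (ThetaSetting.modelχq p i j hj).Compat) :
    ContH1.res (MonoidHom.id (CurveTheta.GTheta (curveχq p i j))) (ThetaSetting.modelχq p i j hj).DeltaTheta
      (hC.deltaTheta_le_DtpYTheta.trans (Subgroup.map_mono inf_le_left)) (zClassYχq p i j hj) =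
      (ThetaSetting.modelχq p i j hj).logTheta :=
  res_zClassχq_eq_logTheta p i j hj _ _

/-- **`res_{Δ_Θ} zClassYddχq = log(Θ)`** (stage 2). [cite: MochizukiEtTh2009, Prop 1.5 (ii) p.23] -/
theorem res_zClassYddχq_eq_logTheta (hj : Even j) (hC : (ThetaSetting.modelχq p i j hj).Compat) :
    ContH1.res (MonoidHom.id (CurveTheta.GTheta (curveχq p i j))) (ThetaSetting.modelχq p i j hj).DeltaTheta
      (hC.deltaTheta_le_DtpYddTheta.trans (Subgroup.map_mono inf_le_left)) (zClassYddχq p i j hj) =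
      (ThetaSetting.modelχq p i j hj).logTheta :=
  res_zClassχq_eq_logTheta p i j hj _ _

/-- **`η̈♯ ∈ H¹(Π^tp_Ÿ, Δ_Θ)`** of the stage-2 model: the inflation of the `z`-class (the class that "arises from"
`zClassYddχq`). [cite: MochizukiEtTh2009, Prop 1.5 (iii) p.23] -/
def etaDdχq (hj : Even j) : (ThetaSetting.modelχq p i j hj).H1 (ThetaSetting.modelχq p i j hj).GtpYdd :=
  (ThetaSetting.modelχq p i j hj).inflTheta (ThetaSetting.modelχq p i j hj).GtpYdd (zClassYddχq p i j hj)

/-- [cite: MochizukiEtTh2009, Prop 1.5 (iii) p.23] -/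
theorem etaDdχq_def (hj : Even j) :
    etaDdχq p i j hj =
      (ThetaSetting.modelχq p i j hj).inflTheta (ThetaSetting.modelχq p i j hj).GtpYdd (zClassYddχq p i j hj) := rfl

/-- `η̈♯` arises from a class on `(Π^tp_Ÿ)^Θ` restricting to `log(Θ)` (existence half of the first clause of
Prop. 1.5 (iii), stage 2). [cite: MochizukiEtTh2009, Prop 1.5 (iii) p.23] -/
theorem exists_lift_etaDdχq (hj : Even j) (hC : (ThetaSetting.modelχq p i j hj).Compat) :
    ∃ x' : (ThetaSetting.modelχq p i j hj).H1Theta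
        ((ThetaSetting.modelχq p i j hj).GtpYdd.map (ThetaSetting.modelχq p i j hj).toTheta),
      (ThetaSetting.modelχq p i j hj).inflTheta (ThetaSetting.modelχq p i j hj).GtpYdd x' = etaDdχq p i j hj ∧
      ContH1.res (MonoidHom.id (CurveTheta.GTheta (curveχq p i j))) (ThetaSetting.modelχq p i j hj).DeltaTheta
        (hC.deltaTheta_le_DtpYddTheta.trans (Subgroup.map_mono inf_le_left)) x' =
        (ThetaSetting.modelχq p i j hj).logTheta :=
  ⟨zClassYddχq p i j hj, rfl, res_zClassYddχq_eq_logTheta p i j hj hC⟩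

end Literature.AnabelianGeometry.EtaleTheta.SettingModel

end
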